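import Literature.Geometry.Lorentzian.ChartSecondFundamentalForm
import Literature.Geometry.Lorentzian.HypersurfaceRestriction
import HarnessLib

/-!
# The second fundamental form of a map from an arbitrary manifold into a chart domain

Support file (everything proved, no named facts) for the explicit vacuum spacetime of
`Literature.Geometry.Lorentzian.christodoulou_trapped_surface_formation_holds` (the null expansions
of a round sphere `S² → V ⊆ E4`).

`ChartSecondFundamentalForm.lean` computes the induced covariant derivative `D_v ν` of a field
`ν` along a map `f : U → V` between *chart domains* `U : Opens E'`, `V : Opens E`:
`D_v ν = DN(y) v + Γ_{f y}(N y)(DΦ(y) v)` (O'Neill 1983, Ch. 4, Lemma 4.1, in the constant frame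
of the chart). Here the same formula is proved for an arbitrary boundaryless source manifold `N`
(e.g. a compact surface), the representatives being replaced by the manifold derivatives of `f`
and of the `E`-valued map `x ↦ ν x`:

* `OpensChart.mdifferentiableAt_lift_of_mdifferentiableAt`, `contMDiffAt_lift_iff` — the lift
  `x ↦ (f x, ν x) ∈ TV` is differentiable / `C^m` iff `f` and `x ↦ ν x ∈ E` are;
* `OpensChart.normalDerivAlong_eq_mfderiv` — `D_v ν = d(ν)_y v + Γ_{f y}(ν y)(df_y v)`;
* `OpensChart.secondFundamentalForm_eq_mfderiv` — `K_ν(v, w) = g(d(ν)_y v + Γ(ν y)(df v), df w)`.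

## References

* B. O'Neill, *Semi-Riemannian geometry with applications to relativity*, Academic Press 1983,
  Ch. 4, Lemma 4.1 (induced connection along a submanifold), Lemma 4.4 ff. (shape tensor).
  [ONeill1983]
-/

noncomputable section

open Bundle TopologicalSpace Manifold Set Module
open scoped ContDiff Topology Manifold

namespace Literature.Geometry.Lorentzian

namespace OpensChart

variable {E : Type*} [NormedAddCommGroup E] [NormedSpace ℝ E] [FiniteDimensional ℝ E]
  {V : Opens E} {n : ℕ∞ω}
  {g : PseudoRiemannianMetric 𝓘(ℝ, E) n E (TangentSpace 𝓘(ℝ, E) : V → Type _)}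
  {G : E → E →L[ℝ] E →L[ℝ] ℝ}
  {EN : Type*} [NormedAddCommGroup EN] [NormedSpace ℝ EN] {HN : Type*} [TopologicalSpace HN]
  {IN : ModelWithCorners ℝ EN HN} {N : Type*} [TopologicalSpace N] [ChartedSpace HN N]

/-! ### The lift `x ↦ (f x, ν x)` into `TV` -/

omit [FiniteDimensional ℝ E] [TopologicalSpace N] in
/-- For a chart domain `V`, the fibre coordinate of the lift of a field `ν` along `f : N → V` in
the (identity) trivialisation of `TV` is the `E`-valued map `x ↦ ν x`. [folklore] -/
theorem trivializationAt_lift_snd {f : N → V} (ν : NormalField 𝓘(ℝ, E) f) (x₀ x : N) :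
    (trivializationAt E (TangentSpace 𝓘(ℝ, E) : V → Type _) (f x₀)
      (TotalSpace.mk' E (f x) (ν x) : TangentBundle 𝓘(ℝ, E) V)).2 = (ν x : E) :=
  congrArg Prod.snd (trivializationAt_apply (f x₀) (f x) (ν x))

omit [FiniteDimensional ℝ E] in
/-- **Differentiability of the lift**: if `f : N → V` and the `E`-valued map `x ↦ ν x` are
differentiable at `y`, so is `x ↦ (f x, ν x) ∈ TV` (the hypothesis of
`secondFundamentalForm_apply`). [folklore] -/
theorem mdifferentiableAt_lift_of_mdifferentiableAt {f : N → V} {ν : NormalField 𝓘(ℝ, E) f}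
    {y : N} (hf : MDifferentiableAt IN 𝓘(ℝ, E) f y)
    (hν : MDifferentiableAt IN 𝓘(ℝ, E) (fun x ↦ (ν x : E)) y) :
    MDifferentiableAt IN (𝓘(ℝ, E).prod 𝓘(ℝ, E))
      (fun x ↦ (TotalSpace.mk' E (f x) (ν x) : TangentBundle 𝓘(ℝ, E) V)) y := by
  rw [mdifferentiableAt_totalSpace]
  refine ⟨hf, ?_⟩
  have h : (fun x : N ↦ (trivializationAt E (TangentSpace 𝓘(ℝ, E)) (f y)
      (TotalSpace.mk' E (f x) (ν x) : TangentBundle 𝓘(ℝ, E) V)).2) = fun x : N ↦ (ν x : E) :=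
    funext fun x ↦ trivializationAt_lift_snd ν y x
  rw [h]
  exact hν

omit [FiniteDimensional ℝ E] in
/-- **Regularity of the lift**: `x ↦ (f x, ν x) ∈ TV` is `C^m` at `y` iff `f` and the `E`-valued
map `x ↦ ν x` are. [folklore] -/
theorem contMDiffAt_lift_iff {f : N → V} {ν : NormalField 𝓘(ℝ, E) f} {y : N} {m : ℕ∞ω} :
    ContMDiffAt IN (𝓘(ℝ, E).prod 𝓘(ℝ, E)) m
        (fun x ↦ (TotalSpace.mk' E (f x) (ν x) : TangentBundle 𝓘(ℝ, E) V)) y ↔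
      ContMDiffAt IN 𝓘(ℝ, E) m f y ∧ ContMDiffAt IN 𝓘(ℝ, E) m (fun x ↦ (ν x : E)) y := by
  rw [contMDiffAt_totalSpace]
  have h : (fun x : N ↦ (trivializationAt E (TangentSpace 𝓘(ℝ, E)) (f y)
      (TotalSpace.mk' E (f x) (ν x) : TangentBundle 𝓘(ℝ, E) V)).2) = fun x : N ↦ (ν x : E) :=
    funext fun x ↦ trivializationAt_lift_snd ν y x
  rw [h]

omit [FiniteDimensional ℝ E] in
/-- The differential of `f : N → V` is that of `Subtype.val ∘ f : N → E` (the inclusion of the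
chart domain has the identity as differential). [folklore] -/
theorem mfderiv_subtypeVal_comp {f : N → V} {y : N} (hf : MDifferentiableAt IN 𝓘(ℝ, E) f y) :
    mfderiv IN 𝓘(ℝ, E) (Subtype.val ∘ f) y = mfderiv IN 𝓘(ℝ, E) f y := by
  rw [mfderiv_comp y (hasMFDerivAt_subtypeVal (f y)).mdifferentiableAt hf, mfderiv_subtypeVal]
  exact ContinuousLinearMap.id_comp _

omit [FiniteDimensional ℝ E] in
/-- `f : N → V` is differentiable at `y` iff `Subtype.val ∘ f : N → E` is. [folklore] -/
theorem mdifferentiableAt_iff_subtypeVal_comp {f : N → V} {y : N} :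
    MDifferentiableAt IN 𝓘(ℝ, E) f y ↔ MDifferentiableAt IN 𝓘(ℝ, E) (Subtype.val ∘ f) y := by
  constructor
  · intro hf
    exact (hasMFDerivAt_subtypeVal (f y)).mdifferentiableAt.comp y hf
  · intro h
    exact (ChartedSpace.liftPropWithinAt_subtypeVal_comp_iff f univ y).mp h

omit [FiniteDimensional ℝ E] in
/-- `f : N → V` is `C^m` at `y` iff `Subtype.val ∘ f : N → E` is. [folklore] -/
theorem contMDiffAt_iff_subtypeVal_comp {f : N → V} {y : N} {m : ℕ∞ω} :
    ContMDiffAt IN 𝓘(ℝ, E) m f y ↔ ContMDiffAt IN 𝓘(ℝ, E) m (Subtype.val ∘ f) y :=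
  (ChartedSpace.liftPropWithinAt_subtypeVal_comp_iff f univ y).symm

/-! ### The induced covariant derivative along `f : N → V` -/

/-- **The induced covariant derivative along a map into a chart domain.** Let `g` be a metric on
`V : Opens E` with components `G` (`g.val x = G x`) differentiable at `f y`, `f : N → V`
differentiable at the interior point `y`, and `ν` a field along `f` whose `E`-valued map
`x ↦ ν x` is differentiable at `y`. Then
`D_v ν = d(x ↦ ν x)_y v + Γ_{f y}(ν y)(df_y v)` with `Γ_x(Z)(X) = christoffel g G x Z X = ∇_X Z`
on constant fields (O'Neill 1983, Ch. 4, Lemma 4.1, `D̄_V X̄ = ∑ V(fⁱ) ∂ᵢ + ∑ fⁱ D̄_V ∂ᵢ`, read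
in the constant frame of the chart). [cite: ONeill1983, Ch. 4, Lemma 4.1] -/
theorem normalDerivAlong_eq_mfderiv [IsManifold IN ∞ N] [g.HasLeviCivita]
    (hG : ∀ x : V, g.val x = G x) {f : N → V} {ν : NormalField 𝓘(ℝ, E) f} {y : N}
    (hy : IN.IsInteriorPoint y) (hf : MDifferentiableAt IN 𝓘(ℝ, E) f y)
    (hν : MDifferentiableAt IN 𝓘(ℝ, E) (fun x ↦ (ν x : E)) y)
    (hGd : DifferentiableAt ℝ G (f y)) (v : TangentSpace IN y) :
    g.normalDerivAlong f ν y v =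
      (show E from mfderiv IN 𝓘(ℝ, E) (fun x ↦ (ν x : E)) y v) +
        christoffel g G (f y) (ν y) (mfderiv IN 𝓘(ℝ, E) f y v) := by
  have hlift := mdifferentiableAt_lift_of_mdifferentiableAt hf hν
  rw [g.normalDerivAlong_eq (I' := IN) hy hlift v]
  set b := Module.finBasis ℝ E with hb
  have h1 : ∀ i, mfderiv IN 𝓘(ℝ, ℝ) (fun x : N ↦
      (trivializationAt E (TangentSpace 𝓘(ℝ, E) : V → Type _) (f y)).localFrame_coeff 𝓘(ℝ, E) b
        i (f x) (ν x)) y v = b.repr (mfderiv IN 𝓘(ℝ, E) (fun x ↦ (ν x : E)) y v) i := by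
    intro i
    set L : E →L[ℝ] ℝ := LinearMap.toContinuousLinearMap (b.coord i) with hL
    have hrep : (fun x : N ↦ (trivializationAt E (TangentSpace 𝓘(ℝ, E) : V → Type _)
        (f y)).localFrame_coeff 𝓘(ℝ, E) b i (f x) (ν x)) = L ∘ fun x ↦ (ν x : E) := by
      funext x
      rw [localFrame_coeff_trivializationAt]
      rfl
    rw [hrep]
    have hc : HasMFDerivAt IN 𝓘(ℝ, ℝ) ((L : E → ℝ) ∘ fun x ↦ (ν x : E)) y
        ((L : E →L[ℝ] ℝ).comp (mfderiv IN 𝓘(ℝ, E) (fun x ↦ (ν x : E)) y)) :=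
      L.hasMFDerivAt.comp y hν.hasMFDerivAt
    rw [hc.mfderiv]
    rfl
  have h2 : ∀ i, (trivializationAt E (TangentSpace 𝓘(ℝ, E) : V → Type _) (f y)).localFrame b i
      (f y) = b i := fun i ↦ by
    rw [localFrame_trivializationAt]
  have h3 : ∀ i, (trivializationAt E (TangentSpace 𝓘(ℝ, E) : V → Type _) (f y)).localFrame_coeff
      𝓘(ℝ, E) b i (f y) (ν y) = b.repr (ν y : E) i := fun i ↦ by
    rw [localFrame_coeff_trivializationAt]
  have h4 : ∀ i, g.leviCivita ((trivializationAt E (TangentSpace 𝓘(ℝ, E) : V → Type _)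
      (f y)).localFrame b i) (f y) (mfderiv IN 𝓘(ℝ, E) f y v) =
      christoffel g G (f y) (b i) (mfderiv IN 𝓘(ℝ, E) f y v) := fun i ↦ by
    rw [localFrame_trivializationAt, leviCivita_const hG (f y) hGd]
    rfl
  refine Eq.trans (b := ∑ i, (b.repr (mfderiv IN 𝓘(ℝ, E) (fun x ↦ (ν x : E)) y v) i) • (b i : E) +
    ∑ i, (b.repr (ν y : E) i) • christoffel g G (f y) (b i) (mfderiv IN 𝓘(ℝ, E) f y v)) ?_ ?_
  · congr 1
    · refine Finset.sum_congr rfl fun i _ ↦ ?_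
      rw [h2 i]
      exact congrArg (fun c : ℝ ↦ c • (b i : E)) (h1 i)
    · refine Finset.sum_congr rfl fun i _ ↦ ?_
      rw [h3 i, h4 i]
      rfl
  · rw [b.sum_repr, ← christoffel_sum, b.sum_repr]

/-- **The second fundamental form of a map into a chart domain**, with respect to a field `ν`
along it: `K_ν(v, w) = g_{f y}(d(ν)_y v + Γ_{f y}(ν y)(df_y v), df_y w)` (O'Neill 1983, Ch. 4,
Lemma 4.1 and Lemma 4.4 ff.; Wald 1984, (10.2.13); `secondFundamentalForm_apply` with
`normalDerivAlong_eq_mfderiv`). [cite: ONeill1983, Ch. 4, Lemma 4.1] -/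
theorem secondFundamentalForm_eq_mfderiv [IsManifold IN ∞ N] [FiniteDimensional ℝ EN]
    [g.HasLeviCivita] (hG : ∀ x : V, g.val x = G x) {f : N → V} {ν : NormalField 𝓘(ℝ, E) f}
    {y : N} (hy : IN.IsInteriorPoint y) (hf : MDifferentiableAt IN 𝓘(ℝ, E) f y)
    (hν : MDifferentiableAt IN 𝓘(ℝ, E) (fun x ↦ (ν x : E)) y)
    (hGd : DifferentiableAt ℝ G (f y)) (v w : TangentSpace IN y) :
    g.secondFundamentalForm IN f ν y v w =
      g.val (f y) ((show E from mfderiv IN 𝓘(ℝ, E) (fun x ↦ (ν x : E)) y v) +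
        christoffel g G (f y) (ν y) (mfderiv IN 𝓘(ℝ, E) f y v)) (mfderiv IN 𝓘(ℝ, E) f y w) := by
  rw [PseudoRiemannianMetric.secondFundamentalForm_apply_holds (I' := IN) hy
    (mdifferentiableAt_lift_of_mdifferentiableAt hf hν) v w,
    normalDerivAlong_eq_mfderiv hG hy hf hν hGd]

end OpensChart

end Literature.Geometry.Lorentzian
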